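import Literature.Computability.Cryptography.WordRAMStructuredBlocks
import Mathlib.Algebra.BigOperators.Intervals
import Mathlib.Tactic.Ring
import Mathlib.Tactic.Linarith
import HarnessLib

/-!
# The word RAM — the level tables of the bilinear evaluation algorithm

A structured word-RAM program (`SProg`) computing, level by level, the tables of the bilinear
algorithm that evaluates a Kronecker power of a decomposed tensor
(`Literature.Computability.AlgebraicComplexity.contractLevel`, file `KroneckerPowEvaluation.lean`;
Bürgisser–Clausen–Shokrollahi Prop. (15.26); the step "this evaluation can be done using
`O((R̃(T_k)+ε/2)^r)` field operations" of K. Pratt, STOC 2024, proof of Thm. 1.9 — ninth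
instalment of the proof of `Literature.Computability.AlgebraicComplexity.pratt2024_thm_1_9`).
The machine works with `w`-bit words, so the tables are computed MODULO `2^w`:

* `levN N R q w Uc x j P A` — the level tables over `ℕ` reduced modulo `2^w`
  (`levN (j+1) P A = (∑_{d<N} Uc (P % R) d · levN j (P / R) (d N^{q-j-1} + A)) % 2^w`), the exact
  contents the program leaves (their comparison with `contractLevel` over `ZMod (2^w)` is one cast,
  done by the consumer);
* the program `SProg.dpProg` = `whilenz 55 levelBody`, four nested counting loops
  (levels `j`, contraction strings `P`, free indices `A`, contracted digit `d`), registers `50–72`,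
  layout: coefficient table `Uc i d` at `rU + i N + d`, level `j` at
  `levelBase rL R N q j + P · N^{q-j} + A` (levels stored back to back from `rL`);
* `dpProg_spec`: started with level `0` (the input vector) in place and its registers set up,
  the program fills in every level `j ≤ q` with `levN j` within `dpTime N R q` steps, touching
  nothing outside its registers and the level region.

## References

* P. Bürgisser, M. Clausen, M. A. Shokrollahi, *Algebraic Complexity Theory*, Springer 1997,
  Prop. (15.26).
* K. Pratt, *A stronger connection between the asymptotic rank conjecture and the set cover
  conjecture*, STOC 2024, arXiv:2311.02774, §2 (proof of Thm. 1.9).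
* T. Nipkow, G. Klein, *Concrete Semantics with Isabelle/HOL*, Springer 2014, §12.2.
-/

namespace Literature.Computability.Cryptography.WordRAM

open StateTransition Finset

open scoped BigOperators

/-! ## Word arithmetic that is allowed to wrap -/

/-- Word multiplication is multiplication modulo `2^w`. [folklore] -/
theorem BinOp.eval_mul_mod (w x y : ℕ) : BinOp.mul.eval w x y = x * y % 2 ^ w := rfl

/-- Word addition is addition modulo `2^w`. [folklore] -/
theorem BinOp.eval_add_mod (w x y : ℕ) : BinOp.add.eval w x y = (x + y) % 2 ^ w := rfl

/-! ## The specification: level tables modulo `2^w` -/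

/-- **The level tables modulo the word size.** Level `0` is the input vector `x`; level `j + 1`
at contraction string `P` and free index `A` is
`(∑_{d<N} Uc (P % R) d · level j (P / R) (d · N^{q-j-1} + A)) mod 2^w` — the recurrence of
`AlgebraicComplexity.contractLevel` computed in `w`-bit words. [cite: BurgisserClausenShokrollahi1997, Prop. 15.26] -/
def levN (N R q w : ℕ) (Uc : ℕ → ℕ → ℕ) (x : ℕ → ℕ) : ℕ → ℕ → ℕ → ℕ
  | 0, _, A => x A
  | j + 1, P, A => (∑ d ∈ range N,
      Uc (P % R) d * levN N R q w Uc x j (P / R) (d * N ^ (q - (j + 1)) + A)) % 2 ^ w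

/-- Level `0`. [folklore] -/
@[simp] theorem levN_zero (N R q w : ℕ) (Uc : ℕ → ℕ → ℕ) (x : ℕ → ℕ) (P A : ℕ) :
    levN N R q w Uc x 0 P A = x A := rfl

/-- The recurrence. [folklore] -/
theorem levN_succ (N R q w : ℕ) (Uc : ℕ → ℕ → ℕ) (x : ℕ → ℕ) (j P A : ℕ) :
    levN N R q w Uc x (j + 1) P A = (∑ d ∈ range N,
      Uc (P % R) d * levN N R q w Uc x j (P / R) (d * N ^ (q - (j + 1)) + A)) % 2 ^ w := rfl

/-- Positive levels are words. [folklore] -/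
theorem levN_succ_lt (N R q w : ℕ) (Uc : ℕ → ℕ → ℕ) (x : ℕ → ℕ) (j P A : ℕ) :
    levN N R q w Uc x (j + 1) P A < 2 ^ w := Nat.mod_lt _ (Nat.two_pow_pos w)

/-- All levels are words if the input is. [folklore] -/
theorem levN_lt {N R q w : ℕ} {Uc : ℕ → ℕ → ℕ} {x : ℕ → ℕ} (hx : ∀ A, x A < 2 ^ w) :
    ∀ j P A, levN N R q w Uc x j P A < 2 ^ w
  | 0, _, A => hx A
  | j + 1, P, A => levN_succ_lt N R q w Uc x j P A

/-- The size `∑_{j' < j} R^{j'} N^{q-j'}` of the first `j` levels, and the base address of level `j`.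
[folklore] -/
def levelBase (rL R N q j : ℕ) : ℕ := rL + ∑ j' ∈ range j, R ^ j' * N ^ (q - j')

/-- Level `0` starts at `rL`. [folklore] -/
@[simp] theorem levelBase_zero (rL R N q : ℕ) : levelBase rL R N q 0 = rL := by simp [levelBase]

/-- Consecutive levels are back to back. [folklore] -/
theorem levelBase_succ (rL R N q j : ℕ) :
    levelBase rL R N q (j + 1) = levelBase rL R N q j + R ^ j * N ^ (q - j) := by
  simp [levelBase, sum_range_succ, Nat.add_assoc]

/-- Level bases increase. [folklore] -/
theorem levelBase_mono (rL R N q : ℕ) {i j : ℕ} (h : i ≤ j) :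
    levelBase rL R N q i ≤ levelBase rL R N q j := by
  unfold levelBase
  exact Nat.add_le_add_left (sum_le_sum_of_subset (range_subset_range.2 h)) _

/-- The partial sums of one entry of a level, modulo `2^w` (the accumulator of the inner loop).
[folklore] -/
def accN (w : ℕ) (f : ℕ → ℕ) (e : ℕ) : ℕ := (∑ d ∈ range e, f d) % 2 ^ w

/-- Empty accumulator. [folklore] -/
@[simp] theorem accN_zero (w : ℕ) (f : ℕ → ℕ) : accN w f 0 = 0 := by simp [accN]

/-- One more term, in word arithmetic. [folklore] -/
theorem accN_succ (w : ℕ) (f : ℕ → ℕ) (e : ℕ) :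
    accN w f (e + 1) = (accN w f e + f e % 2 ^ w) % 2 ^ w := by
  unfold accN
  rw [sum_range_succ, Nat.add_mod]

/-- Accumulators are words. [folklore] -/
theorem accN_lt (w : ℕ) (f : ℕ → ℕ) (e : ℕ) : accN w f e < 2 ^ w := Nat.mod_lt _ (Nat.two_pow_pos w)

namespace SProg

variable {w : ℕ} {O : List ℕ → List ℕ}

/-! ## The inner product loop (digit `d`)

Registers: `59` = stride `szA`, `64` = count, `65` = accumulator, `66` = coefficient pointer,
`67` = source pointer, `69` = temporary. -/

/-- Body: `t := mem[coef]; t := t * mem[src]; acc := acc + t; coef += 1; src += szA; cnt -= 1`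
(products and sums wrap modulo `2^w`). [folklore] -/
def dBody : List OpSpec :=
  [(.add, .dir 69, .ind 66, .imm 0), (.mul, .dir 69, .dir 69, .ind 67),
    (.add, .dir 65, .dir 65, .dir 69), (.add, .dir 66, .dir 66, .imm 1),
    (.add, .dir 67, .dir 67, .dir 59), (.sub, .dir 64, .dir 64, .imm 1)]

/-- The inner product loop. [folklore] -/
def dLoop : SProg := whilenz (.dir 64) (block dBody)

/-- Invariant of the inner product loop after `e` terms: the accumulator holds
`accN w (fun d => coef d * cell d) e` where `coef d = m (coef₀ + d)`, `cell d = m (src₀ + d szA)`.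
[folklore] -/
structure DInv (m : ℕ → ℕ) (Nd coef₀ src₀ szA : ℕ) (qs : List (List ℕ)) (e : ℕ) (st : Store) :
    Prop where
  queries : st.queries = qs
  r59 : st.mem 59 = szA
  r64 : st.mem 64 = Nd - e
  r65 : st.mem 65 = accN w (fun d => m (coef₀ + d) * m (src₀ + d * szA)) e
  r66 : st.mem 66 = coef₀ + e
  r67 : st.mem 67 = src₀ + e * szA
  frame : ∀ a, a ≠ 64 → a ≠ 65 → a ≠ 66 → a ≠ 67 → a ≠ 69 → st.mem a = m a

set_option linter.unusedSimpArgs false in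
/-- One term of the inner product. [folklore] -/
theorem dBody_spec {m : ℕ → ℕ} {Nd coef₀ src₀ szA : ℕ} {qs : List (List ℕ)} {e : ℕ}
    (he : e < Nd) (hcoef : 100 ≤ coef₀) (hsrc : 100 ≤ src₀) (hcoefN : coef₀ + Nd < 2 ^ w)
    (hsrcN : src₀ + Nd * szA < 2 ^ w) (hcv : ∀ d, d < Nd → m (coef₀ + d) < 2 ^ w)
    {st : Store} (h : DInv (w := w) m Nd coef₀ src₀ szA qs e st) :
    ∃ st', Exec w O (block dBody) st st' 6 ∧ DInv (w := w) m Nd coef₀ src₀ szA qs (e + 1) st' := by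
  obtain ⟨hq, h59, h64, h65, h66, h67, hfr⟩ := h
  obtain ⟨mm, qq⟩ := st
  simp only at hq h59 h64 h65 h66 h67 hfr
  subst qq
  have hce : mm (coef₀ + e) = m (coef₀ + e) := hfr _ (by omega) (by omega) (by omega) (by omega) (by omega)
  have hse : mm (src₀ + e * szA) = m (src₀ + e * szA) :=
    hfr _ (by omega) (by omega) (by omega) (by omega) (by omega)
  have hcve : m (coef₀ + e) < 2 ^ w := hcv e he
  have hesz : e * szA + szA ≤ Nd * szA := by
    have : (e + 1) * szA ≤ Nd * szA := Nat.mul_le_mul_right _ he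
    rwa [Nat.succ_mul] at this
  have hacc : accN w (fun d => m (coef₀ + d) * m (src₀ + d * szA)) e < 2 ^ w := accN_lt _ _ _
  refine Exec.block_of_fwd dBody qs fun Rf hR => ?_
  unfold dBody at hR
  -- op 1: t := mem[coef₀ + e]
  have htmp := execOps_cons_fwd hR; clear hR; obtain ⟨v1, hv1, hR⟩ := htmp
  simp -failIfUnchanged (disch := omega) only [Operand.write, Operand.read,
    Function.update_self, Function.update_of_ne, BinOp.eval_add_mod, Nat.mod_eq_of_lt, Nat.add_zero,
    h66, hce] at hv1 hR
  subst v1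
  -- op 2: t := t * mem[src] % 2^w
  have htmp := execOps_cons_fwd hR; clear hR; obtain ⟨v2, hv2, hR⟩ := htmp
  simp -failIfUnchanged (disch := omega) only [Operand.write, Operand.read,
    Function.update_self, Function.update_of_ne, BinOp.eval_mul_mod, Nat.add_zero, h67, hse] at hv2 hR
  subst v2
  -- op 3: acc := (acc + t) % 2^w
  have htmp := execOps_cons_fwd hR; clear hR; obtain ⟨v3, hv3, hR⟩ := htmp
  simp -failIfUnchanged (disch := omega) only [Operand.write, Operand.read,
    Function.update_self, Function.update_of_ne, BinOp.eval_add_mod, Nat.add_zero, h65] at hv3 hR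
  subst v3
  -- op 4: coef += 1
  have htmp := execOps_cons_fwd hR; clear hR; obtain ⟨v4, hv4, hR⟩ := htmp
  simp -failIfUnchanged (disch := omega) only [Operand.write, Operand.read,
    Function.update_self, Function.update_of_ne, BinOp.eval_add_mod, Nat.mod_eq_of_lt, Nat.add_zero,
    h66] at hv4 hR
  subst v4
  -- op 5: src += szA
  have htmp := execOps_cons_fwd hR; clear hR; obtain ⟨v5, hv5, hR⟩ := htmp
  simp -failIfUnchanged (disch := omega) only [Operand.write, Operand.read,
    Function.update_self, Function.update_of_ne, BinOp.eval_add_mod, Nat.mod_eq_of_lt, Nat.add_zero,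
    h67, h59] at hv5 hR
  subst v5
  -- op 6: cnt -= 1
  have htmp := execOps_cons_fwd hR; clear hR; obtain ⟨v6, hv6, hR⟩ := htmp
  simp -failIfUnchanged (disch := omega) only [Operand.write, Operand.read,
    Function.update_self, Function.update_of_ne, BinOp.eval_sub_of_le, Nat.add_zero, h64] at hv6 hR
  subst v6
  simp only [execOps_nil] at hR
  subst hR
  refine ⟨rfl, ?_, ?_, ?_, ?_, ?_, fun a ha64 ha65 ha66 ha67 ha69 => ?_⟩ <;> dsimp only
  · simp (disch := omega) only [Function.update_of_ne, Function.update_self]; exact h59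
  · simp (disch := omega) only [Function.update_of_ne, Function.update_self]; omega
  · simp (disch := omega) only [Function.update_of_ne, Function.update_self]
    rw [accN_succ]
  · simp (disch := omega) only [Function.update_of_ne, Function.update_self]; omega
  · simp (disch := omega) only [Function.update_of_ne, Function.update_self]
    rw [Nat.succ_mul]; omega
  · simp (disch := omega) only [Function.update_of_ne, Function.update_self]
    exact hfr a ha64 ha65 ha66 ha67 ha69

/-- **The inner product loop**: from count `Nd` in `64`, accumulator `0` in `65`, pointers
`coef₀` in `66` and `src₀` in `67` (stride `szA` in `59`), `dLoop` ends within `8 Nd + 1` steps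
with `accN w (coef · cell) Nd` in `65`. [folklore] -/
theorem dLoop_spec {m : ℕ → ℕ} {Nd coef₀ src₀ szA : ℕ} (h59 : m 59 = szA) (h64 : m 64 = Nd)
    (h65 : m 65 = 0) (h66 : m 66 = coef₀) (h67 : m 67 = src₀) (hcoef : 100 ≤ coef₀)
    (hsrc : 100 ≤ src₀) (hcoefN : coef₀ + Nd < 2 ^ w) (hsrcN : src₀ + Nd * szA < 2 ^ w)
    (hcv : ∀ d, d < Nd → m (coef₀ + d) < 2 ^ w) (qs : List (List ℕ)) :
    ∃ st', ExecLE w O dLoop ⟨m, qs⟩ st' (Nd * 8 + 1) ∧ DInv (w := w) m Nd coef₀ src₀ szA qs Nd st' := by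
  have h0 : DInv (w := w) m Nd coef₀ src₀ szA qs 0 ⟨m, qs⟩ :=
    ⟨rfl, h59, by simpa using h64, by simpa using h65, by simpa using h66, by simpa using h67,
      fun a _ _ _ _ _ => rfl⟩
  exact ExecLE.whilenz_invariant (w := w) (O := O) (x := .dir 64) (s := block dBody) Nd 6
    (fun e st => DInv (w := w) m Nd coef₀ src₀ szA qs e st)
    (fun e he st hst => ⟨by rw [Operand.read_dir, hst.r64]; omega,
      by obtain ⟨st', hex, hinv⟩ := dBody_spec (w := w) (O := O) he hcoef hsrc hcoefN hsrcN hcv hst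
         exact ⟨st', hex.execLE, hinv⟩⟩)
    (fun st hst => by rw [Operand.read_dir, hst.r64]; omega) h0

/-! ## The loop over free indices `A`

Registers: `50` = `rU`, `52` = `N`, `56` = `Bp` (base of the previous level), `59` = `szA`,
`62` = count, `63` = `A`, `68` = destination pointer, `70` = `t2 = N · szA`, `71` = `i`,
`72` = `Pq`; the inner loop's `64–67, 69`. -/

/-- Before the inner product: `acc := 0; coef := rU + i N; src := Bp + Pq t2 + A; cnt := N`. [folklore] -/
def aPre : List OpSpec :=
  [(.add, .dir 65, .imm 0, .imm 0), (.mul, .dir 66, .dir 71, .dir 52),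
    (.add, .dir 66, .dir 50, .dir 66), (.mul, .dir 67, .dir 72, .dir 70),
    (.add, .dir 67, .dir 56, .dir 67), (.add, .dir 67, .dir 67, .dir 63),
    (.add, .dir 64, .dir 52, .imm 0)]

/-- After the inner product: `mem[dst] := acc; dst += 1; A += 1; cnt -= 1`. [folklore] -/
def aPost : List OpSpec :=
  [(.add, .ind 68, .dir 65, .imm 0), (.add, .dir 68, .dir 68, .imm 1),
    (.add, .dir 63, .dir 63, .imm 1), (.sub, .dir 62, .dir 62, .imm 1)]

/-- The body of the `A` loop. [folklore] -/
def aBody : SProg := seq (block aPre) (seq dLoop (block aPost))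

/-- The `A` loop. [folklore] -/
def aLoop : SProg := whilenz (.dir 62) aBody

/-- The value written for free index `a`: the inner product of row `i` of the coefficient table with
the stride-`szA` column of the previous level starting at `Bp + Pq t2 + a`, modulo `2^w`. [folklore] -/
def aVal (w : ℕ) (m : ℕ → ℕ) (rU N Bp Pq t2 szA i a : ℕ) : ℕ :=
  accN w (fun d => m (rU + i * N + d) * m (Bp + Pq * t2 + a + d * szA)) N

/-- Invariant of the `A` loop after `a` entries. [folklore] -/
structure AInv (m : ℕ → ℕ) (rU N Bp szA dst₀ t2 i Pq : ℕ) (qs : List (List ℕ)) (a : ℕ)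
    (st : Store) : Prop where
  queries : st.queries = qs
  r50 : st.mem 50 = rU
  r52 : st.mem 52 = N
  r56 : st.mem 56 = Bp
  r59 : st.mem 59 = szA
  r62 : st.mem 62 = szA - a
  r63 : st.mem 63 = a
  r68 : st.mem 68 = dst₀ + a
  r70 : st.mem 70 = t2
  r71 : st.mem 71 = i
  r72 : st.mem 72 = Pq
  written : ∀ a', a' < a → st.mem (dst₀ + a') = aVal w m rU N Bp Pq t2 szA i a'
  frame : ∀ c, c ≠ 62 → c ≠ 63 → c ≠ 64 → c ≠ 65 → c ≠ 66 → c ≠ 67 → c ≠ 68 → c ≠ 69 →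
    ¬ (dst₀ ≤ c ∧ c < dst₀ + a) → st.mem c = m c

/-- The registers the inner loop needs, as set by `aPre`. [folklore] -/
structure APreInv (m : ℕ → ℕ) (rU N Bp szA dst₀ t2 i Pq : ℕ) (qs : List (List ℕ)) (a : ℕ)
    (st : Store) : Prop where
  queries : st.queries = qs
  r50 : st.mem 50 = rU
  r52 : st.mem 52 = N
  r56 : st.mem 56 = Bp
  r70 : st.mem 70 = t2
  r71 : st.mem 71 = i
  r72 : st.mem 72 = Pq
  r59 : st.mem 59 = szA
  r64 : st.mem 64 = N
  r65 : st.mem 65 = 0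
  r66 : st.mem 66 = rU + i * N
  r67 : st.mem 67 = Bp + Pq * t2 + a
  r62 : st.mem 62 = szA - a
  r63 : st.mem 63 = a
  r68 : st.mem 68 = dst₀ + a
  written : ∀ a', a' < a → st.mem (dst₀ + a') = aVal w m rU N Bp Pq t2 szA i a'
  frame : ∀ c, c ≠ 62 → c ≠ 63 → c ≠ 64 → c ≠ 65 → c ≠ 66 → c ≠ 67 → c ≠ 68 → c ≠ 69 →
    ¬ (dst₀ ≤ c ∧ c < dst₀ + a) → st.mem c = m c

/-- The static side conditions of the `A` loop (addresses are data addresses, nothing wraps, the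
destination segment lies above the coefficient row and the source block). [folklore] -/
structure ASide (w : ℕ) (m : ℕ → ℕ) (rU N Bp szA dst₀ t2 i Pq : ℕ) : Prop where
  hrU : 100 ≤ rU
  hBp : 100 ≤ Bp
  hcoef_dst : rU + i * N + N ≤ dst₀
  hsrc_dst : Bp + Pq * t2 + N * szA ≤ dst₀
  hdst : dst₀ + szA < 2 ^ w
  hcv : ∀ d, d < N → m (rU + i * N + d) < 2 ^ w

set_option linter.unusedSimpArgs false in
/-- `aPre` sets up the inner loop. [folklore] -/
theorem aPre_spec {m : ℕ → ℕ} {rU N Bp szA dst₀ t2 i Pq : ℕ} {qs : List (List ℕ)} {a : ℕ}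
    (ha : a < szA) (hS : ASide w m rU N Bp szA dst₀ t2 i Pq) {st : Store}
    (h : AInv (w := w) m rU N Bp szA dst₀ t2 i Pq qs a st) :
    ∃ st', Exec w O (block aPre) st st' 7 ∧ APreInv (w := w) m rU N Bp szA dst₀ t2 i Pq qs a st' := by
  obtain ⟨hrU, hBp, hcd, hsd, hdst, hcv⟩ := hS
  obtain ⟨hq, h50, h52, h56, h59, h62, h63, h68, h70, h71, h72, hwr, hfr⟩ := h
  obtain ⟨mm, qq⟩ := st
  simp only at hq h50 h52 h56 h59 h62 h63 h68 h70 h71 h72 hwr hfr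
  subst qq
  refine Exec.block_of_fwd aPre qs fun Rf hR => ?_
  unfold aPre at hR
  have htmp := execOps_cons_fwd hR; clear hR; obtain ⟨v1, hv1, hR⟩ := htmp
  simp -failIfUnchanged (disch := omega) only [Operand.write, Operand.read,
    Function.update_self, Function.update_of_ne, BinOp.eval_add_mod, Nat.mod_eq_of_lt,
    Nat.add_zero] at hv1 hR
  subst v1
  have htmp := execOps_cons_fwd hR; clear hR; obtain ⟨v2, hv2, hR⟩ := htmp
  simp -failIfUnchanged (disch := omega) only [Operand.write, Operand.read,
    Function.update_self, Function.update_of_ne, BinOp.eval_mul_mod, Nat.mod_eq_of_lt,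
    Nat.add_zero, h71, h52] at hv2 hR
  subst v2
  have htmp := execOps_cons_fwd hR; clear hR; obtain ⟨v3, hv3, hR⟩ := htmp
  simp -failIfUnchanged (disch := omega) only [Operand.write, Operand.read,
    Function.update_self, Function.update_of_ne, BinOp.eval_add_mod, Nat.mod_eq_of_lt,
    Nat.add_zero, h50] at hv3 hR
  subst v3
  have htmp := execOps_cons_fwd hR; clear hR; obtain ⟨v4, hv4, hR⟩ := htmp
  simp -failIfUnchanged (disch := omega) only [Operand.write, Operand.read,
    Function.update_self, Function.update_of_ne, BinOp.eval_mul_mod, Nat.mod_eq_of_lt,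
    Nat.add_zero, h72, h70] at hv4 hR
  subst v4
  have htmp := execOps_cons_fwd hR; clear hR; obtain ⟨v5, hv5, hR⟩ := htmp
  simp -failIfUnchanged (disch := omega) only [Operand.write, Operand.read,
    Function.update_self, Function.update_of_ne, BinOp.eval_add_mod, Nat.mod_eq_of_lt,
    Nat.add_zero, h56] at hv5 hR
  subst v5
  have htmp := execOps_cons_fwd hR; clear hR; obtain ⟨v6, hv6, hR⟩ := htmp
  simp -failIfUnchanged (disch := omega) only [Operand.write, Operand.read,
    Function.update_self, Function.update_of_ne, BinOp.eval_add_mod, Nat.mod_eq_of_lt,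
    Nat.add_zero, h63] at hv6 hR
  subst v6
  have htmp := execOps_cons_fwd hR; clear hR; obtain ⟨v7, hv7, hR⟩ := htmp
  simp -failIfUnchanged (disch := omega) only [Operand.write, Operand.read,
    Function.update_self, Function.update_of_ne, BinOp.eval_add_mod, Nat.mod_eq_of_lt,
    Nat.add_zero, h52] at hv7 hR
  subst v7
  simp only [execOps_nil] at hR
  subst hR
  refine ⟨rfl, ?_, ?_, ?_, ?_, ?_, ?_, ?_, ?_, ?_, ?_, ?_, ?_, ?_, ?_, fun a' ha' => ?_,
    fun c h62' h63' h64' h65' h66' h67' h68' h69' hnc => ?_⟩ <;> dsimp only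
  · simp (disch := omega) only [Function.update_of_ne, Function.update_self]; exact h50
  · simp (disch := omega) only [Function.update_of_ne, Function.update_self]; exact h52
  · simp (disch := omega) only [Function.update_of_ne, Function.update_self]; exact h56
  · simp (disch := omega) only [Function.update_of_ne, Function.update_self]; exact h70
  · simp (disch := omega) only [Function.update_of_ne, Function.update_self]; exact h71
  · simp (disch := omega) only [Function.update_of_ne, Function.update_self]; exact h72
  · simp (disch := omega) only [Function.update_of_ne, Function.update_self]; exact h59
  · simp (disch := omega) only [Function.update_of_ne, Function.update_self]
  · simp (disch := omega) only [Function.update_of_ne, Function.update_self]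
  · simp (disch := omega) only [Function.update_of_ne, Function.update_self]
  · simp (disch := omega) only [Function.update_of_ne, Function.update_self]
  · simp (disch := omega) only [Function.update_of_ne, Function.update_self]; exact h62
  · simp (disch := omega) only [Function.update_of_ne, Function.update_self]; exact h63
  · simp (disch := omega) only [Function.update_of_ne, Function.update_self]; exact h68
  · simp (disch := omega) only [Function.update_of_ne, Function.update_self]; exact hwr a' ha'
  · simp (disch := omega) only [Function.update_of_ne, Function.update_self]
    exact hfr c h62' h63' h64' h65' h66' h67' h68' h69' hnc

set_option linter.unusedSimpArgs false in
/-- `aPost` stores the inner product and advances. [folklore] -/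
theorem aPost_spec {m : ℕ → ℕ} {rU N Bp szA dst₀ t2 i Pq : ℕ} {qs : List (List ℕ)} {a : ℕ}
    (ha : a < szA) (hS : ASide w m rU N Bp szA dst₀ t2 i Pq) {st₁ st₂ : Store}
    (h₁ : APreInv (w := w) m rU N Bp szA dst₀ t2 i Pq qs a st₁)
    (h₂ : DInv (w := w) st₁.mem N (rU + i * N) (Bp + Pq * t2 + a) szA qs N st₂) :
    ∃ st', Exec w O (block aPost) st₂ st' 4 ∧ AInv (w := w) m rU N Bp szA dst₀ t2 i Pq qs (a + 1) st' := by
  obtain ⟨hrU, hBp, hcd, hsd, hdst, hcv⟩ := hS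
  obtain ⟨hq₁, g50, g52, g56, g70, g71, g72, g59, g64, g65, g66, g67, g62, g63, g68, gwr, gfr⟩ := h₁
  obtain ⟨hq₂, h59, h64, h65, h66, h67, hfr⟩ := h₂
  obtain ⟨mm, qq⟩ := st₂
  simp only at hq₂ h59 h64 h65 h66 h67 hfr
  subst qq
  -- the accumulator holds `aVal a`
  have hval : accN w (fun d => st₁.mem (rU + i * N + d) * st₁.mem (Bp + Pq * t2 + a + d * szA)) N =
      aVal w m rU N Bp Pq t2 szA i a := by
    unfold aVal accN
    congr 1
    refine sum_congr rfl fun d hd => ?_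
    dsimp only
    rw [mem_range] at hd
    have hdsz : d * szA + szA ≤ N * szA := by
      have : (d + 1) * szA ≤ N * szA := Nat.mul_le_mul_right _ hd
      rwa [Nat.succ_mul] at this
    rw [gfr (rU + i * N + d) (by omega) (by omega) (by omega) (by omega) (by omega) (by omega)
        (by omega) (by omega) (by omega),
      gfr (Bp + Pq * t2 + a + d * szA) (by omega) (by omega) (by omega) (by omega) (by omega)
        (by omega) (by omega) (by omega) (by omega)]
  rw [hval] at h65
  have hacc : aVal w m rU N Bp Pq t2 szA i a < 2 ^ w := accN_lt _ _ _
  have h68 : mm 68 = dst₀ + a := by rw [hfr 68 (by omega) (by omega) (by omega) (by omega) (by omega)]; exact g68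
  have h63 : mm 63 = a := by rw [hfr 63 (by omega) (by omega) (by omega) (by omega) (by omega)]; exact g63
  have h62 : mm 62 = szA - a := by rw [hfr 62 (by omega) (by omega) (by omega) (by omega) (by omega)]; exact g62
  refine Exec.block_of_fwd aPost qs fun Rf hR => ?_
  unfold aPost at hR
  have htmp := execOps_cons_fwd hR; clear hR; obtain ⟨v1, hv1, hR⟩ := htmp
  simp -failIfUnchanged (disch := omega) only [Operand.write, Operand.read,
    Function.update_self, Function.update_of_ne, BinOp.eval_add_mod, Nat.mod_eq_of_lt,
    Nat.add_zero, h68, h65] at hv1 hR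
  subst v1
  have htmp := execOps_cons_fwd hR; clear hR; obtain ⟨v2, hv2, hR⟩ := htmp
  simp -failIfUnchanged (disch := omega) only [Operand.write, Operand.read,
    Function.update_self, Function.update_of_ne, BinOp.eval_add_mod, Nat.mod_eq_of_lt,
    Nat.add_zero, h68] at hv2 hR
  subst v2
  have htmp := execOps_cons_fwd hR; clear hR; obtain ⟨v3, hv3, hR⟩ := htmp
  simp -failIfUnchanged (disch := omega) only [Operand.write, Operand.read,
    Function.update_self, Function.update_of_ne, BinOp.eval_add_mod, Nat.mod_eq_of_lt,
    Nat.add_zero, h63] at hv3 hR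
  subst v3
  have htmp := execOps_cons_fwd hR; clear hR; obtain ⟨v4, hv4, hR⟩ := htmp
  simp -failIfUnchanged (disch := omega) only [Operand.write, Operand.read,
    Function.update_self, Function.update_of_ne, BinOp.eval_sub_of_le, Nat.add_zero, h62] at hv4 hR
  subst v4
  simp only [execOps_nil] at hR
  subst hR
  -- from `mm` back to `m` on untouched cells
  have hback : ∀ c, c ≠ 62 → c ≠ 63 → c ≠ 64 → c ≠ 65 → c ≠ 66 → c ≠ 67 → c ≠ 68 → c ≠ 69 →
      ¬ (dst₀ ≤ c ∧ c < dst₀ + a) → mm c = m c := by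
    intro c h62' h63' h64' h65' h66' h67' h68' h69' hnc
    rw [hfr c h64' h65' h66' h67' h69']
    exact gfr c h62' h63' h64' h65' h66' h67' h68' h69' hnc
  refine ⟨rfl, ?_, ?_, ?_, ?_, ?_, ?_, ?_, ?_, ?_, ?_, fun a' ha' => ?_,
    fun c h62' h63' h64' h65' h66' h67' h68' h69' hnc => ?_⟩ <;> dsimp only
  · simp (disch := omega) only [Function.update_of_ne, Function.update_self]
    rw [hfr 50 (by omega) (by omega) (by omega) (by omega) (by omega)]; exact g50
  · simp (disch := omega) only [Function.update_of_ne, Function.update_self]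
    rw [hfr 52 (by omega) (by omega) (by omega) (by omega) (by omega)]; exact g52
  · simp (disch := omega) only [Function.update_of_ne, Function.update_self]
    rw [hfr 56 (by omega) (by omega) (by omega) (by omega) (by omega)]; exact g56
  · simp (disch := omega) only [Function.update_of_ne, Function.update_self]; exact h59
  · simp (disch := omega) only [Function.update_of_ne, Function.update_self]; omega
  · simp (disch := omega) only [Function.update_of_ne, Function.update_self]
  · simp (disch := omega) only [Function.update_of_ne, Function.update_self]; omega
  · simp (disch := omega) only [Function.update_of_ne, Function.update_self]
    rw [hfr 70 (by omega) (by omega) (by omega) (by omega) (by omega)]; exact g70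
  · simp (disch := omega) only [Function.update_of_ne, Function.update_self]
    rw [hfr 71 (by omega) (by omega) (by omega) (by omega) (by omega)]; exact g71
  · simp (disch := omega) only [Function.update_of_ne, Function.update_self]
    rw [hfr 72 (by omega) (by omega) (by omega) (by omega) (by omega)]; exact g72
  · rcases Nat.lt_succ_iff_lt_or_eq.1 ha' with hlt | rfl
    · simp (disch := omega) only [Function.update_of_ne, Function.update_self]
      rw [hfr (dst₀ + a') (by omega) (by omega) (by omega) (by omega) (by omega)]
      exact gwr a' hlt
    · simp (disch := omega) only [Function.update_of_ne, Function.update_self]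
  · simp (disch := omega) only [Function.update_of_ne, Function.update_self]
    exact hback c h62' h63' h64' h65' h66' h67' h68' h69' (fun hh => hnc ⟨hh.1, by omega⟩)

/-- One iteration of the `A` loop: `7 + (8N + 1) + 4` steps. [folklore] -/
theorem aBody_spec {m : ℕ → ℕ} {rU N Bp szA dst₀ t2 i Pq : ℕ} {qs : List (List ℕ)} {a : ℕ}
    (ha : a < szA) (hS : ASide w m rU N Bp szA dst₀ t2 i Pq) {st : Store}
    (h : AInv (w := w) m rU N Bp szA dst₀ t2 i Pq qs a st) :
    ∃ st', ExecLE w O aBody st st' (N * 8 + 12) ∧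
      AInv (w := w) m rU N Bp szA dst₀ t2 i Pq qs (a + 1) st' := by
  obtain ⟨st₁, hex₁, h₁⟩ := aPre_spec (w := w) (O := O) ha hS h
  obtain ⟨mm₁, qq₁⟩ := st₁
  have hq₁ : qq₁ = qs := h₁.queries
  subst qq₁
  have hcv₁ : ∀ d, d < N → mm₁ (rU + i * N + d) < 2 ^ w := fun d hd => by
    have := h₁.frame (rU + i * N + d) (by have := hS.hrU; omega) (by have := hS.hrU; omega)
      (by have := hS.hrU; omega) (by have := hS.hrU; omega) (by have := hS.hrU; omega)
      (by have := hS.hrU; omega) (by have := hS.hrU; omega) (by have := hS.hrU; omega)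
      (by have := hS.hcoef_dst; omega)
    simp only at this
    rw [this]; exact hS.hcv d hd
  obtain ⟨st₂, hex₂, h₂⟩ := dLoop_spec (w := w) (O := O) (m := mm₁) h₁.r59 h₁.r64 h₁.r65 h₁.r66
    h₁.r67 (by have := hS.hrU; omega) (by have := hS.hBp; omega)
    (by have := hS.hcoef_dst; have := hS.hdst; omega)
    (by have := hS.hsrc_dst; have := hS.hdst; omega) hcv₁ qs
  obtain ⟨st₃, hex₃, h₃⟩ := aPost_spec (w := w) (O := O) ha hS h₁ h₂
  exact ⟨st₃, ((hex₁.execLE).seq (hex₂.seq hex₃.execLE)).mono (by omega), h₃⟩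

/-- **The `A` loop**: `szA` entries of the new level, within `szA (8N + 14) + 1` steps. [folklore] -/
theorem aLoop_spec {m : ℕ → ℕ} {rU N Bp szA dst₀ t2 i Pq : ℕ} {qs : List (List ℕ)}
    (hS : ASide w m rU N Bp szA dst₀ t2 i Pq) {st : Store}
    (h : AInv (w := w) m rU N Bp szA dst₀ t2 i Pq qs 0 st) :
    ∃ st', ExecLE w O aLoop st st' (szA * (N * 8 + 14) + 1) ∧
      AInv (w := w) m rU N Bp szA dst₀ t2 i Pq qs szA st' :=
  ExecLE.whilenz_invariant (w := w) (O := O) (x := .dir 62) (s := aBody) szA (N * 8 + 12)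
    (fun a st => AInv (w := w) m rU N Bp szA dst₀ t2 i Pq qs a st)
    (fun a ha st hst => ⟨by rw [Operand.read_dir, hst.r62]; omega, aBody_spec ha hS hst⟩)
    (fun st hst => by rw [Operand.read_dir, hst.r62]; omega) h

/-! ## The loop over contraction strings `P`

Registers: `53` = `R`, `57` = `Bc` (base of the level being written), `60` = count, `61` = `P`,
and those of the `A` loop. -/

/-- Before the `A` loop: `i := P mod R; Pq := P / R; A := 0; cnt := szA`. [folklore] -/
def pPre : List OpSpec :=
  [(.mod, .dir 71, .dir 61, .dir 53), (.div, .dir 72, .dir 61, .dir 53),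
    (.add, .dir 63, .imm 0, .imm 0), (.add, .dir 62, .dir 59, .imm 0)]

/-- After the `A` loop: `P += 1; cnt -= 1`. [folklore] -/
def pPost : List OpSpec :=
  [(.add, .dir 61, .dir 61, .imm 1), (.sub, .dir 60, .dir 60, .imm 1)]

/-- The body of the `P` loop. [folklore] -/
def pBody : SProg := seq (block pPre) (seq aLoop (block pPost))

/-- The `P` loop. [folklore] -/
def pLoop : SProg := whilenz (.dir 60) pBody

/-- The value written at `(P, a)` of the new level. [folklore] -/
def pVal (w : ℕ) (m : ℕ → ℕ) (rU N R Bp t2 szA P a : ℕ) : ℕ :=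
  aVal w m rU N Bp (P / R) t2 szA (P % R) a

/-- Invariant of the `P` loop after `p` strings. [folklore] -/
structure PInv (m : ℕ → ℕ) (rU N R Bp Bc szA SP t2 : ℕ) (qs : List (List ℕ)) (p : ℕ)
    (st : Store) : Prop where
  queries : st.queries = qs
  r50 : st.mem 50 = rU
  r52 : st.mem 52 = N
  r53 : st.mem 53 = R
  r56 : st.mem 56 = Bp
  r57 : st.mem 57 = Bc
  r59 : st.mem 59 = szA
  r60 : st.mem 60 = SP - p
  r61 : st.mem 61 = p
  r68 : st.mem 68 = Bc + p * szA
  r70 : st.mem 70 = t2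
  written : ∀ P a, P < p → a < szA → st.mem (Bc + P * szA + a) = pVal w m rU N R Bp t2 szA P a
  frame : ∀ c, c ≠ 60 → c ≠ 61 → c ≠ 62 → c ≠ 63 → c ≠ 64 → c ≠ 65 → c ≠ 66 → c ≠ 67 → c ≠ 68 →
    c ≠ 69 → c ≠ 71 → c ≠ 72 → ¬ (Bc ≤ c ∧ c < Bc + p * szA) → st.mem c = m c

/-- The static side conditions of the `P` loop. [folklore] -/
structure PSide (w : ℕ) (m : ℕ → ℕ) (rU N R Bp Bc szA SP t2 : ℕ) : Prop where
  hrU : 100 ≤ rU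
  hBp : 100 ≤ Bp
  hR : 1 ≤ R
  hcoef : rU + R * N ≤ Bc
  hsrc : ∀ P, P < SP → Bp + P / R * t2 + N * szA ≤ Bc
  hdst : Bc + SP * szA < 2 ^ w
  hSP : SP < 2 ^ w
  hcv : ∀ i d, i < R → d < N → m (rU + i * N + d) < 2 ^ w

/-- Row `i < R` of the coefficient table ends below `rU + R N`. [folklore] -/
theorem coef_row_le {rU N R i : ℕ} (hi : i < R) : rU + i * N + N ≤ rU + R * N := by
  have : (i + 1) * N ≤ R * N := Nat.mul_le_mul_right _ hi
  rw [Nat.succ_mul] at this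
  omega

/-- Entry `P < SP` of a segment of stride `szA` ends within `SP · szA`. [folklore] -/
theorem seg_le {P SP szA : ℕ} (hP : P < SP) : P * szA + szA ≤ SP * szA := by
  have : (P + 1) * szA ≤ SP * szA := Nat.mul_le_mul_right _ hP
  rwa [Nat.succ_mul] at this

set_option linter.unusedSimpArgs false in
/-- `pPre` sets up the `A` loop for string `p` (the `A` loop is then run against the memory it
leaves, `AInv st'.mem … 0 st'`). [folklore] -/
theorem pPre_spec {m : ℕ → ℕ} {rU N R Bp Bc szA SP t2 : ℕ} {qs : List (List ℕ)} {p : ℕ}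
    (hp : p < SP) (hS : PSide w m rU N R Bp Bc szA SP t2) {st : Store}
    (h : PInv (w := w) m rU N R Bp Bc szA SP t2 qs p st) :
    ∃ st', Exec w O (block pPre) st st' 4 ∧
      AInv (w := w) st'.mem rU N Bp szA (Bc + p * szA) t2 (p % R) (p / R) qs 0 st' ∧
      st'.mem 53 = R ∧ st'.mem 57 = Bc ∧ st'.mem 60 = SP - p ∧ st'.mem 61 = p ∧
      (∀ c, c ≠ 62 → c ≠ 63 → c ≠ 71 → c ≠ 72 → st'.mem c = st.mem c) := by
  obtain ⟨hrU, hBp, hR, hcoef, hsrc, hdst, hSP, hcv⟩ := hS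
  obtain ⟨hq, h50, h52, h53, h56, h57, h59, h60, h61, h68, h70, hwr, hfr⟩ := h
  obtain ⟨mm, qq⟩ := st
  simp only at hq h50 h52 h53 h56 h57 h59 h60 h61 h68 h70 hwr hfr ⊢
  subst qq
  have hpszA : p * szA + szA ≤ SP * szA := seg_le hp
  refine Exec.block_of_fwd pPre qs fun Rf hR' => ?_
  unfold pPre at hR'
  have htmp := execOps_cons_fwd hR'; clear hR'; obtain ⟨v1, hv1, hR'⟩ := htmp
  simp -failIfUnchanged (disch := omega) only [Operand.write, Operand.read,
    Function.update_self, Function.update_of_ne, BinOp.eval_mod, Nat.add_zero, h61, h53] at hv1 hR'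
  subst v1
  have htmp := execOps_cons_fwd hR'; clear hR'; obtain ⟨v2, hv2, hR'⟩ := htmp
  simp -failIfUnchanged (disch := omega) only [Operand.write, Operand.read,
    Function.update_self, Function.update_of_ne, BinOp.eval_div, Nat.add_zero, h61, h53] at hv2 hR'
  subst v2
  have htmp := execOps_cons_fwd hR'; clear hR'; obtain ⟨v3, hv3, hR'⟩ := htmp
  simp -failIfUnchanged (disch := omega) only [Operand.write, Operand.read,
    Function.update_self, Function.update_of_ne, BinOp.eval_add_mod, Nat.mod_eq_of_lt,
    Nat.add_zero] at hv3 hR'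
  subst v3
  have htmp := execOps_cons_fwd hR'; clear hR'; obtain ⟨v4, hv4, hR'⟩ := htmp
  simp -failIfUnchanged (disch := omega) only [Operand.write, Operand.read,
    Function.update_self, Function.update_of_ne, BinOp.eval_add_mod, Nat.mod_eq_of_lt,
    Nat.add_zero, h59] at hv4 hR'
  subst v4
  simp only [execOps_nil] at hR'
  subst hR'
  refine ⟨⟨rfl, ?_, ?_, ?_, ?_, ?_, ?_, ?_, ?_, ?_, ?_, fun a' ha' => (Nat.not_lt_zero _ ha').elim,
    fun c _ _ _ _ _ _ _ _ _ => rfl⟩, ?_, ?_, ?_, ?_, fun c h62' h63' h71' h72' => ?_⟩ <;> dsimp only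
  · simp (disch := omega) only [Function.update_of_ne, Function.update_self]; exact h50
  · simp (disch := omega) only [Function.update_of_ne, Function.update_self]; exact h52
  · simp (disch := omega) only [Function.update_of_ne, Function.update_self]; exact h56
  · simp (disch := omega) only [Function.update_of_ne, Function.update_self]; exact h59
  · simp (disch := omega) only [Function.update_of_ne, Function.update_self]; omega
  · simp (disch := omega) only [Function.update_of_ne, Function.update_self]
  · simp (disch := omega) only [Function.update_of_ne, Function.update_self]; omega
  · simp (disch := omega) only [Function.update_of_ne, Function.update_self]; exact h70
  · simp (disch := omega) only [Function.update_of_ne, Function.update_self]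
  · simp (disch := omega) only [Function.update_of_ne, Function.update_self]
  · simp (disch := omega) only [Function.update_of_ne, Function.update_self]; exact h53
  · simp (disch := omega) only [Function.update_of_ne, Function.update_self]; exact h57
  · simp (disch := omega) only [Function.update_of_ne, Function.update_self]; exact h60
  · simp (disch := omega) only [Function.update_of_ne, Function.update_self]; exact h61
  · simp (disch := omega) only [Function.update_of_ne, Function.update_self]

set_option linter.unusedSimpArgs false in
/-- `pPost` advances to the next string. [folklore] -/
theorem pPost_spec {m : ℕ → ℕ} {rU N R Bp Bc szA SP t2 : ℕ} {qs : List (List ℕ)} {p : ℕ}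
    (hp : p < SP) (hS : PSide w m rU N R Bp Bc szA SP t2) {st st₁ st₂ : Store}
    (h : PInv (w := w) m rU N R Bp Bc szA SP t2 qs p st)
    (h₁ : st₁.mem 53 = R ∧ st₁.mem 57 = Bc ∧ st₁.mem 60 = SP - p ∧ st₁.mem 61 = p ∧
      (∀ c, c ≠ 62 → c ≠ 63 → c ≠ 71 → c ≠ 72 → st₁.mem c = st.mem c))
    (h₂ : AInv (w := w) st₁.mem rU N Bp szA (Bc + p * szA) t2 (p % R) (p / R) qs szA st₂) :
    ∃ st', Exec w O (block pPost) st₂ st' 2 ∧ PInv (w := w) m rU N R Bp Bc szA SP t2 qs (p + 1) st' := by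
  obtain ⟨hrU, hBp, hR, hcoef, hsrc, hdst, hSP, hcv⟩ := hS
  obtain ⟨g53, g57, g60, g61, gfr⟩ := h₁
  obtain ⟨hq₂, h50, h52, h56, h59, h62, h63, h68, h70, h71, h72, hwr, hfr⟩ := h₂
  obtain ⟨mm, qq⟩ := st₂
  simp only at hq₂ h50 h52 h56 h59 h62 h63 h68 h70 h71 h72 hwr hfr
  subst qq
  have hpszA : p * szA + szA ≤ SP * szA := seg_le hp
  have hmod : p % R < R := Nat.mod_lt _ (by omega)
  have hdivR : p / R < SP := lt_of_le_of_lt (Nat.div_le_self _ _) hp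
  -- cells untouched since the start of the iteration
  have hkeep : ∀ c, c ≠ 60 → c ≠ 61 → c ≠ 62 → c ≠ 63 → c ≠ 64 → c ≠ 65 → c ≠ 66 → c ≠ 67 →
      c ≠ 68 → c ≠ 69 → c ≠ 71 → c ≠ 72 → ¬ (Bc + p * szA ≤ c ∧ c < Bc + p * szA + szA) →
      mm c = st.mem c := by
    intro c h60' h61' h62' h63' h64' h65' h66' h67' h68' h69' h71' h72' hnc
    rw [hfr c h62' h63' h64' h65' h66' h67' h68' h69' hnc]
    exact gfr c h62' h63' h71' h72'
  -- the values written are `pVal` of the reference memory `m`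
  have hval : ∀ a', a' < szA → aVal w st₁.mem rU N Bp (p / R) t2 szA (p % R) a' =
      pVal w m rU N R Bp t2 szA p a' := by
    intro a' ha'
    unfold pVal aVal accN
    congr 1
    refine sum_congr rfl fun d hd => ?_
    dsimp only
    rw [mem_range] at hd
    have hrow := coef_row_le (rU := rU) (N := N) hmod
    have hsrcp := hsrc p hp
    have hdsz : d * szA + szA ≤ N * szA := seg_le hd
    rw [gfr (rU + p % R * N + d) (by omega) (by omega) (by omega) (by omega),
      gfr (Bp + p / R * t2 + a' + d * szA) (by omega) (by omega) (by omega) (by omega),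
      h.frame (rU + p % R * N + d) (by omega) (by omega) (by omega) (by omega) (by omega) (by omega)
        (by omega) (by omega) (by omega) (by omega) (by omega) (by omega) (by omega),
      h.frame (Bp + p / R * t2 + a' + d * szA) (by omega) (by omega) (by omega) (by omega)
        (by omega) (by omega) (by omega) (by omega) (by omega) (by omega) (by omega) (by omega)
        (by omega)]
  have h60 : mm 60 = SP - p := by
    rw [hfr 60 (by omega) (by omega) (by omega) (by omega) (by omega) (by omega) (by omega)
      (by omega) (by omega)]; exact g60
  have h61 : mm 61 = p := by
    rw [hfr 61 (by omega) (by omega) (by omega) (by omega) (by omega) (by omega) (by omega)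
      (by omega) (by omega)]; exact g61
  refine Exec.block_of_fwd pPost qs fun Rf hR' => ?_
  unfold pPost at hR'
  have htmp := execOps_cons_fwd hR'; clear hR'; obtain ⟨v1, hv1, hR'⟩ := htmp
  simp -failIfUnchanged (disch := omega) only [Operand.write, Operand.read,
    Function.update_self, Function.update_of_ne, BinOp.eval_add_mod, Nat.mod_eq_of_lt,
    Nat.add_zero, h61] at hv1 hR'
  subst v1
  have htmp := execOps_cons_fwd hR'; clear hR'; obtain ⟨v2, hv2, hR'⟩ := htmp
  simp -failIfUnchanged (disch := omega) only [Operand.write, Operand.read,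
    Function.update_self, Function.update_of_ne, BinOp.eval_sub_of_le, Nat.add_zero, h60] at hv2 hR'
  subst v2
  simp only [execOps_nil] at hR'
  subst hR'
  refine ⟨rfl, ?_, ?_, ?_, ?_, ?_, ?_, ?_, ?_, ?_, ?_, fun P a' hP ha' => ?_,
    fun c h60' h61' h62' h63' h64' h65' h66' h67' h68' h69' h71' h72' hnc => ?_⟩ <;> dsimp only
  · simp (disch := omega) only [Function.update_of_ne, Function.update_self]; exact h50
  · simp (disch := omega) only [Function.update_of_ne, Function.update_self]; exact h52
  · simp (disch := omega) only [Function.update_of_ne, Function.update_self]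
    rw [hfr 53 (by omega) (by omega) (by omega) (by omega) (by omega) (by omega) (by omega)
      (by omega) (by omega)]; exact g53
  · simp (disch := omega) only [Function.update_of_ne, Function.update_self]; exact h56
  · simp (disch := omega) only [Function.update_of_ne, Function.update_self]
    rw [hfr 57 (by omega) (by omega) (by omega) (by omega) (by omega) (by omega) (by omega)
      (by omega) (by omega)]; exact g57
  · simp (disch := omega) only [Function.update_of_ne, Function.update_self]; exact h59
  · simp (disch := omega) only [Function.update_of_ne, Function.update_self]; omega
  · simp (disch := omega) only [Function.update_of_ne, Function.update_self]
  · simp (disch := omega) only [Function.update_of_ne, Function.update_self]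
    rw [h68, Nat.succ_mul, Nat.add_assoc]
  · simp (disch := omega) only [Function.update_of_ne, Function.update_self]; exact h70
  · -- written entries: old strings from `PInv`, the new string from `AInv`
    have hPa : P * szA + a' < P * szA + szA := by omega
    have hPsz : P * szA + szA ≤ (p + 1) * szA := by
      have : (P + 1) * szA ≤ (p + 1) * szA := Nat.mul_le_mul_right _ hP
      rwa [Nat.succ_mul] at this
    rw [Nat.succ_mul] at hPsz
    simp (disch := omega) only [Function.update_of_ne, Function.update_self]
    rcases Nat.lt_succ_iff_lt_or_eq.1 hP with hlt | rfl
    · have hPsz' : P * szA + szA ≤ p * szA := by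
        have : (P + 1) * szA ≤ p * szA := Nat.mul_le_mul_right _ hlt
        rwa [Nat.succ_mul] at this
      rw [hkeep (Bc + P * szA + a') (by omega) (by omega) (by omega) (by omega) (by omega)
        (by omega) (by omega) (by omega) (by omega) (by omega) (by omega) (by omega) (by omega)]
      exact h.written P a' hlt ha'
    · rw [hwr a' ha', hval a' ha']
  · have hc : ¬ (Bc + p * szA ≤ c ∧ c < Bc + p * szA + szA) := fun hh =>
      hnc ⟨by omega, by rw [Nat.succ_mul]; omega⟩
    simp (disch := omega) only [Function.update_of_ne, Function.update_self]
    rw [hkeep c h60' h61' h62' h63' h64' h65' h66' h67' h68' h69' h71' h72' hc]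
    exact h.frame c h60' h61' h62' h63' h64' h65' h66' h67' h68' h69' h71' h72'
      (fun hh => hnc ⟨hh.1, by rw [Nat.succ_mul]; omega⟩)

/-- One iteration of the `P` loop. [folklore] -/
theorem pBody_spec {m : ℕ → ℕ} {rU N R Bp Bc szA SP t2 : ℕ} {qs : List (List ℕ)} {p : ℕ}
    (hp : p < SP) (hS : PSide w m rU N R Bp Bc szA SP t2) {st : Store}
    (h : PInv (w := w) m rU N R Bp Bc szA SP t2 qs p st) :
    ∃ st', ExecLE w O pBody st st' (szA * (N * 8 + 14) + 7) ∧
      PInv (w := w) m rU N R Bp Bc szA SP t2 qs (p + 1) st' := by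
  obtain ⟨st₁, hex₁, hA, g53, g57, g60, g61, gfr⟩ := pPre_spec (w := w) (O := O) hp hS h
  have hmod : p % R < R := Nat.mod_lt _ (by have := hS.hR; omega)
  have hpszA : p * szA + szA ≤ SP * szA := seg_le hp
  have hAS : ASide w st₁.mem rU N Bp szA (Bc + p * szA) t2 (p % R) (p / R) := by
    refine ⟨hS.hrU, hS.hBp, ?_, ?_, ?_, fun d hd => ?_⟩
    · have := coef_row_le (rU := rU) (N := N) hmod; have := hS.hcoef; omega
    · have := hS.hsrc p hp; omega
    · have := hS.hdst; omega
    · have hrow := coef_row_le (rU := rU) (N := N) hmod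
      have := hS.hcoef; have := hS.hrU
      rw [gfr (rU + p % R * N + d) (by omega) (by omega) (by omega) (by omega),
        h.frame (rU + p % R * N + d) (by omega) (by omega) (by omega) (by omega) (by omega)
          (by omega) (by omega) (by omega) (by omega) (by omega) (by omega) (by omega) (by omega)]
      exact hS.hcv _ _ hmod hd
  obtain ⟨st₂, hex₂, hA₂⟩ := aLoop_spec (w := w) (O := O) hAS hA
  obtain ⟨st₃, hex₃, hP⟩ := pPost_spec (w := w) (O := O) hp hS h ⟨g53, g57, g60, g61, gfr⟩ hA₂
  exact ⟨st₃, ((hex₁.execLE).seq (hex₂.seq hex₃.execLE)).mono (by omega), hP⟩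

/-- **The `P` loop**: all `SP` strings of the new level within `SP (szA (8N + 14) + 9) + 1` steps.
[folklore] -/
theorem pLoop_spec {m : ℕ → ℕ} {rU N R Bp Bc szA SP t2 : ℕ} {qs : List (List ℕ)}
    (hS : PSide w m rU N R Bp Bc szA SP t2) {st : Store}
    (h : PInv (w := w) m rU N R Bp Bc szA SP t2 qs 0 st) :
    ∃ st', ExecLE w O pLoop st st' (SP * (szA * (N * 8 + 14) + 9) + 1) ∧
      PInv (w := w) m rU N R Bp Bc szA SP t2 qs SP st' :=
  ExecLE.whilenz_invariant (w := w) (O := O) (x := .dir 60) (s := pBody) SP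
    (szA * (N * 8 + 14) + 7) (fun p st => PInv (w := w) m rU N R Bp Bc szA SP t2 qs p st)
    (fun p hp st hst => ⟨by rw [Operand.read_dir, hst.r60]; omega, pBody_spec hp hS hst⟩)
    (fun st hst => by rw [Operand.read_dir, hst.r60]; omega) h

/-! ## The loop over levels

Registers: `55` = levels still to do, `56` = base of the last complete level, `57` = base of the
level to write, `58` = its number of strings `R^{j+1}` (kept modulo `2^w`), `59` = its number of
free indices `N^{q-1-j}` (as an iterated quotient). -/

/-- Before the `P` loop: `t2 := N · szA; P := 0; cnt := sizeP; dst := Bc`. [folklore] -/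
def lPre : List OpSpec :=
  [(.mul, .dir 70, .dir 52, .dir 59), (.add, .dir 61, .imm 0, .imm 0),
    (.add, .dir 60, .dir 58, .imm 0), (.add, .dir 68, .dir 57, .imm 0)]

/-- After the `P` loop: `Bp := Bc; Bc := dst; sizeP := sizeP · R; szA := szA / N; cnt -= 1`. [folklore] -/
def lPost : List OpSpec :=
  [(.add, .dir 56, .dir 57, .imm 0), (.add, .dir 57, .dir 68, .imm 0),
    (.mul, .dir 58, .dir 58, .dir 53), (.div, .dir 59, .dir 59, .dir 52),
    (.sub, .dir 55, .dir 55, .imm 1)]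

/-- The body of the level loop. [folklore] -/
def levelBody : SProg := seq (block lPre) (seq pLoop (block lPost))

/-- **The program of the level tables**: `while levels remain, compute the next level`. [cite: BurgisserClausenShokrollahi1997, Prop. 15.26] -/
def dpProg : SProg := whilenz (.dir 55) levelBody

/-- `dpProg` is query-free. [folklore] -/
theorem dpProg_queryFree : dpProg.QueryFree :=
  ⟨block_queryFree _, ⟨⟨block_queryFree _, ⟨⟨block_queryFree _, ⟨block_queryFree _,
    block_queryFree _⟩⟩, block_queryFree _⟩⟩, block_queryFree _⟩⟩

/-- The total number of cells of the levels `0, …, q`. [folklore] -/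
def dpSize (R N q : ℕ) : ℕ := ∑ j ∈ range (q + 1), R ^ j * N ^ (q - j)

/-- The end of the level region. [folklore] -/
theorem levelBase_top (rL R N q : ℕ) : levelBase rL R N q (q + 1) = rL + dpSize R N q := rfl

/-- One level is at most the whole region. [folklore] -/
theorem pow_mul_pow_le_dpSize (R N q : ℕ) {j : ℕ} (hj : j ≤ q) : R ^ j * N ^ (q - j) ≤ dpSize R N q := by
  unfold dpSize
  exact single_le_sum (f := fun j => R ^ j * N ^ (q - j)) (fun _ _ => Nat.zero_le _)
    (mem_range.2 (Nat.lt_succ_of_le hj))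

/-- The region has at least `q + 1` cells (`R, N ≥ 1`). [folklore] -/
theorem succ_le_dpSize {R N : ℕ} (hR : 1 ≤ R) (hN : 1 ≤ N) (q : ℕ) : q + 1 ≤ dpSize R N q := by
  unfold dpSize
  calc q + 1 = ∑ _j ∈ range (q + 1), 1 := by simp
    _ ≤ _ := sum_le_sum fun j _ => Nat.mul_pos (Nat.pow_pos (by omega)) (Nat.pow_pos (by omega))

/-- A step bound for `dpProg`: `q` levels, each within `(8N + 23) · dpSize + 12` steps. [folklore] -/
def dpTime (N R q : ℕ) : ℕ := q * ((8 * N + 23) * dpSize R N q + 12) + 1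

/-- Invariant of the level loop after `j` complete levels (beyond level `0`): registers, every level
`j' ≤ j` holds `levN j'`, nothing outside the registers `55–72` and the levels `1, …, q` has
changed. [cite: BurgisserClausenShokrollahi1997, Prop. 15.26] -/
structure LInv (m : ℕ → ℕ) (rU rL N R q : ℕ) (qs : List (List ℕ)) (j : ℕ) (st : Store) : Prop where
  queries : st.queries = qs
  r50 : st.mem 50 = rU
  r52 : st.mem 52 = N
  r53 : st.mem 53 = R
  r55 : st.mem 55 = q - j
  r56 : st.mem 56 = levelBase rL R N q j
  r57 : st.mem 57 = levelBase rL R N q (j + 1)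
  r58 : st.mem 58 = R ^ (j + 1) % 2 ^ w
  r59 : st.mem 59 = N ^ (q - 1) / N ^ j
  data : ∀ j', j' ≤ j → ∀ P A, P < R ^ j' → A < N ^ (q - j') →
    st.mem (levelBase rL R N q j' + P * N ^ (q - j') + A) =
      levN N R q w (fun i d => m (rU + i * N + d)) (fun A => m (rL + A)) j' P A
  frame : ∀ c, (c < 55 ∨ 72 < c) → ¬ (levelBase rL R N q 1 ≤ c ∧ c < levelBase rL R N q (q + 1)) →
    st.mem c = m c

/-- The static side conditions of `dpProg`: coefficient table below the level region, `N, R ≥ 1`,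
the whole region inside the address space, table entries and input words. [folklore] -/
structure LSide (w : ℕ) (m : ℕ → ℕ) (rU rL N R q : ℕ) : Prop where
  hrU : 100 ≤ rU
  hcoef : rU + R * N ≤ rL
  hN : 1 ≤ N
  hR : 1 ≤ R
  hfit : levelBase rL R N q (q + 1) < 2 ^ w
  hcv : ∀ i d, i < R → d < N → m (rU + i * N + d) < 2 ^ w
  hxv : ∀ A, A < N ^ q → m (rL + A) < 2 ^ w

/-- Arithmetic of the level sizes. [folklore] -/
theorem level_sizes {N R q j rL : ℕ} (hN : 1 ≤ N) (hR : 1 ≤ R) (hj : j < q) :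
    N ^ (q - 1) / N ^ j = N ^ (q - (j + 1)) ∧ N * N ^ (q - (j + 1)) = N ^ (q - j) ∧
    R ^ (j + 1) ≤ R ^ (j + 1) * N ^ (q - (j + 1)) ∧ N ^ (q - j) ≤ R ^ j * N ^ (q - j) ∧
    levelBase rL R N q (j + 1) + R ^ (j + 1) * N ^ (q - (j + 1)) = levelBase rL R N q (j + 2) ∧
    levelBase rL R N q (j + 2) ≤ levelBase rL R N q (q + 1) := by
  refine ⟨?_, ?_, ?_, ?_, ?_, ?_⟩
  · rw [Nat.pow_div (by omega) (by omega)]; congr 1; omega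
  · rw [← pow_succ']; congr 1; omega
  · exact Nat.le_mul_of_pos_right _ (Nat.pow_pos (by omega))
  · exact Nat.le_mul_of_pos_left _ (Nat.pow_pos (by omega))
  · rw [levelBase_succ rL R N q (j + 1)]
  · exact levelBase_mono rL R N q (by omega)

set_option linter.unusedSimpArgs false in
/-- `lPre` sets up the `P` loop of level `j + 1`. [folklore] -/
theorem lPre_spec {m : ℕ → ℕ} {rU rL N R q : ℕ} {qs : List (List ℕ)} {j : ℕ} (hj : j < q)
    (hS : LSide w m rU rL N R q) {st : Store} (h : LInv (w := w) m rU rL N R q qs j st) :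
    ∃ st', Exec w O (block lPre) st st' 4 ∧
      PInv (w := w) st'.mem rU N R (levelBase rL R N q j) (levelBase rL R N q (j + 1))
        (N ^ (q - (j + 1))) (R ^ (j + 1)) (N ^ (q - j)) qs 0 st' ∧
      st'.mem 55 = q - j ∧ st'.mem 58 = R ^ (j + 1) % 2 ^ w ∧
      (∀ c, c ≠ 60 → c ≠ 61 → c ≠ 68 → c ≠ 70 → st'.mem c = st.mem c) := by
  obtain ⟨hrU, hcoef, hN, hR, hfit, hcv, hxv⟩ := hS
  obtain ⟨hszA, ht2, hSPle, hNle, hbase2, hbase_le⟩ := level_sizes (rL := rL) hN hR hj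
  obtain ⟨hq, h50, h52, h53, h55, h56, h57, h58, h59, hdata, hfr⟩ := h
  obtain ⟨mm, qq⟩ := st
  simp only at hq h50 h52 h53 h55 h56 h57 h58 h59 hdata hfr ⊢
  subst qq
  rw [hszA] at h59
  have hlev := pow_mul_pow_le_dpSize R N q (show j + 1 ≤ q by omega)
  have hlevj := pow_mul_pow_le_dpSize R N q (show j ≤ q by omega)
  have htop := levelBase_top rL R N q
  have hRj : R ^ (j + 1) < 2 ^ w := by omega
  have h58' : mm 58 = R ^ (j + 1) := by rw [h58, Nat.mod_eq_of_lt hRj]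
  have hb1 : levelBase rL R N q (j + 1) ≤ levelBase rL R N q (q + 1) := levelBase_mono _ _ _ _ (by omega)
  refine Exec.block_of_fwd lPre qs fun Rf hR' => ?_
  unfold lPre at hR'
  have htmp := execOps_cons_fwd hR'; clear hR'; obtain ⟨v1, hv1, hR'⟩ := htmp
  simp -failIfUnchanged (disch := omega) only [Operand.write, Operand.read,
    Function.update_self, Function.update_of_ne, BinOp.eval_mul_mod, Nat.mod_eq_of_lt,
    Nat.add_zero, h52, h59, ht2] at hv1 hR'
  subst v1
  have htmp := execOps_cons_fwd hR'; clear hR'; obtain ⟨v2, hv2, hR'⟩ := htmp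
  simp -failIfUnchanged (disch := omega) only [Operand.write, Operand.read,
    Function.update_self, Function.update_of_ne, BinOp.eval_add_mod, Nat.mod_eq_of_lt,
    Nat.add_zero] at hv2 hR'
  subst v2
  have htmp := execOps_cons_fwd hR'; clear hR'; obtain ⟨v3, hv3, hR'⟩ := htmp
  simp -failIfUnchanged (disch := omega) only [Operand.write, Operand.read,
    Function.update_self, Function.update_of_ne, BinOp.eval_add_mod, Nat.mod_eq_of_lt,
    Nat.add_zero, h58'] at hv3 hR'
  subst v3
  have htmp := execOps_cons_fwd hR'; clear hR'; obtain ⟨v4, hv4, hR'⟩ := htmp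
  simp -failIfUnchanged (disch := omega) only [Operand.write, Operand.read,
    Function.update_self, Function.update_of_ne, BinOp.eval_add_mod, Nat.mod_eq_of_lt,
    Nat.add_zero, h57] at hv4 hR'
  subst v4
  simp only [execOps_nil] at hR'
  subst hR'
  refine ⟨⟨rfl, ?_, ?_, ?_, ?_, ?_, ?_, ?_, ?_, ?_, ?_, fun P a hP _ => (Nat.not_lt_zero _ hP).elim,
    fun c _ _ _ _ _ _ _ _ _ _ _ _ _ => rfl⟩, ?_, ?_, fun c h60' h61' h68' h70' => ?_⟩ <;> dsimp only
  · simp (disch := omega) only [Function.update_of_ne, Function.update_self]; exact h50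
  · simp (disch := omega) only [Function.update_of_ne, Function.update_self]; exact h52
  · simp (disch := omega) only [Function.update_of_ne, Function.update_self]; exact h53
  · simp (disch := omega) only [Function.update_of_ne, Function.update_self]; exact h56
  · simp (disch := omega) only [Function.update_of_ne, Function.update_self]; exact h57
  · simp (disch := omega) only [Function.update_of_ne, Function.update_self]; exact h59
  · simp (disch := omega) only [Function.update_of_ne, Function.update_self]; omega
  · simp (disch := omega) only [Function.update_of_ne, Function.update_self]
  · simp (disch := omega) only [Function.update_of_ne, Function.update_self]; omega
  · simp (disch := omega) only [Function.update_of_ne, Function.update_self]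
  · simp (disch := omega) only [Function.update_of_ne, Function.update_self]; exact h55
  · simp (disch := omega) only [Function.update_of_ne, Function.update_self]; exact h58
  · simp (disch := omega) only [Function.update_of_ne, Function.update_self]

/-- **The values of the new level are `levN (j+1)`.** If a memory `m₁` agrees with the reference
memory `m` on the coefficient table and with a memory holding level `j` (as `levN j`) on level
`j`, then the inner products `pVal` taken in `m₁` are the entries of level `j + 1`. [cite: BurgisserClausenShokrollahi1997, Prop. 15.26] -/
theorem pVal_eq_levN {m m₀ m₁ : ℕ → ℕ} {rU rL N R q j : ℕ} (hN : 1 ≤ N) (hR : 1 ≤ R) (hj : j < q)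
    (hdata : ∀ P A, P < R ^ j → A < N ^ (q - j) →
      m₀ (levelBase rL R N q j + P * N ^ (q - j) + A) =
        levN N R q w (fun i d => m (rU + i * N + d)) (fun A => m (rL + A)) j P A)
    (hcoef : ∀ i d, i < R → d < N → m₁ (rU + i * N + d) = m (rU + i * N + d))
    (hsrc : ∀ c, levelBase rL R N q j ≤ c → c < levelBase rL R N q (j + 1) → m₁ c = m₀ c)
    {P A : ℕ} (hP : P < R ^ (j + 1)) (hA : A < N ^ (q - (j + 1))) :
    pVal w m₁ rU N R (levelBase rL R N q j) (N ^ (q - j)) (N ^ (q - (j + 1))) P A =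
      levN N R q w (fun i d => m (rU + i * N + d)) (fun A => m (rL + A)) (j + 1) P A := by
  obtain ⟨_, ht2, _, _, _, _⟩ := level_sizes (rL := rL) hN hR hj
  have hmod : P % R < R := Nat.mod_lt _ (by omega)
  have hdiv : P / R < R ^ j := by
    rw [Nat.div_lt_iff_lt_mul (by omega)]; rwa [← pow_succ]
  unfold pVal aVal accN
  rw [levN_succ]
  congr 1
  refine sum_congr rfl fun d hd => ?_
  rw [mem_range] at hd
  dsimp only
  have hdA : d * N ^ (q - (j + 1)) + A < N ^ (q - j) := by
    have := seg_le (szA := N ^ (q - (j + 1))) hd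
    omega
  have hin : P / R * N ^ (q - j) + (d * N ^ (q - (j + 1)) + A) < R ^ j * N ^ (q - j) := by
    have := seg_le (szA := N ^ (q - j)) hdiv
    omega
  rw [hcoef _ _ hmod hd, hsrc _ (by omega) (by rw [levelBase_succ]; omega),
    show levelBase rL R N q j + P / R * N ^ (q - j) + A + d * N ^ (q - (j + 1)) =
      levelBase rL R N q j + P / R * N ^ (q - j) + (d * N ^ (q - (j + 1)) + A) by omega,
    hdata _ _ hdiv hdA]

set_option linter.unusedSimpArgs false in
/-- `lPost` closes level `j + 1`. [folklore] -/
theorem lPost_spec {m : ℕ → ℕ} {rU rL N R q : ℕ} {qs : List (List ℕ)} {j : ℕ} (hj : j < q)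
    (hS : LSide w m rU rL N R q) {st st₁ st₂ : Store} (h : LInv (w := w) m rU rL N R q qs j st)
    (h₁ : st₁.mem 55 = q - j ∧ st₁.mem 58 = R ^ (j + 1) % 2 ^ w ∧
      (∀ c, c ≠ 60 → c ≠ 61 → c ≠ 68 → c ≠ 70 → st₁.mem c = st.mem c))
    (h₂ : PInv (w := w) st₁.mem rU N R (levelBase rL R N q j) (levelBase rL R N q (j + 1))
        (N ^ (q - (j + 1))) (R ^ (j + 1)) (N ^ (q - j)) qs (R ^ (j + 1)) st₂) :
    ∃ st', Exec w O (block lPost) st₂ st' 5 ∧ LInv (w := w) m rU rL N R q qs (j + 1) st' := by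
  obtain ⟨hrU, hcoef, hN, hR, hfit, hcv, hxv⟩ := hS
  obtain ⟨hszA, ht2, hSPle, hNle, hbase2, hbase_le⟩ := level_sizes (rL := rL) hN hR hj
  obtain ⟨g55, g58, gfr⟩ := h₁
  obtain ⟨hq₂, h50, h52, h53, h56, h57, h59, h60, h61, h68, h70, hwr, hfr⟩ := h₂
  obtain ⟨mm, qq⟩ := st₂
  simp only at hq₂ h50 h52 h53 h56 h57 h59 h60 h61 h68 h70 hwr hfr
  subst qq
  have hlev := pow_mul_pow_le_dpSize R N q (show j + 1 ≤ q by omega)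
  have hlevj := pow_mul_pow_le_dpSize R N q (show j ≤ q by omega)
  have htop := levelBase_top rL R N q
  have hb1 : levelBase rL R N q 1 ≤ levelBase rL R N q (j + 1) := levelBase_mono _ _ _ _ (by omega)
  have hb0 : rL ≤ levelBase rL R N q j := by
    have := levelBase_mono rL R N q (Nat.zero_le j); rwa [levelBase_zero] at this
  have hbj : levelBase rL R N q j ≤ levelBase rL R N q (j + 1) := levelBase_mono _ _ _ _ (by omega)
  have hrL1 : rL ≤ levelBase rL R N q 1 := by
    have := levelBase_mono rL R N q (Nat.zero_le 1); rwa [levelBase_zero] at this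
  have hqw : q < 2 ^ w := by have := succ_le_dpSize hR hN q; omega
  rw [hbase2] at h68
  have h55 : mm 55 = q - j := by
    rw [hfr 55 (by omega) (by omega) (by omega) (by omega) (by omega) (by omega) (by omega) (by omega)
      (by omega) (by omega) (by omega) (by omega) (by omega)]; exact g55
  have h58 : mm 58 = R ^ (j + 1) % 2 ^ w := by
    rw [hfr 58 (by omega) (by omega) (by omega) (by omega) (by omega) (by omega) (by omega) (by omega)
      (by omega) (by omega) (by omega) (by omega) (by omega)]; exact g58
  refine Exec.block_of_fwd lPost qs fun Rf hR' => ?_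
  unfold lPost at hR'
  have htmp := execOps_cons_fwd hR'; clear hR'; obtain ⟨v1, hv1, hR'⟩ := htmp
  simp -failIfUnchanged (disch := omega) only [Operand.write, Operand.read,
    Function.update_self, Function.update_of_ne, BinOp.eval_add_mod, Nat.mod_eq_of_lt,
    Nat.add_zero, h57] at hv1 hR'
  subst v1
  have htmp := execOps_cons_fwd hR'; clear hR'; obtain ⟨v2, hv2, hR'⟩ := htmp
  simp -failIfUnchanged (disch := omega) only [Operand.write, Operand.read,
    Function.update_self, Function.update_of_ne, BinOp.eval_add_mod, Nat.mod_eq_of_lt,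
    Nat.add_zero, h68] at hv2 hR'
  subst v2
  have htmp := execOps_cons_fwd hR'; clear hR'; obtain ⟨v3, hv3, hR'⟩ := htmp
  simp -failIfUnchanged (disch := omega) only [Operand.write, Operand.read,
    Function.update_self, Function.update_of_ne, BinOp.eval_mul_mod, Nat.add_zero, h58, h53] at hv3 hR'
  subst v3
  have htmp := execOps_cons_fwd hR'; clear hR'; obtain ⟨v4, hv4, hR'⟩ := htmp
  simp -failIfUnchanged (disch := omega) only [Operand.write, Operand.read,
    Function.update_self, Function.update_of_ne, BinOp.eval_div, Nat.add_zero, h59, h52] at hv4 hR'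
  subst v4
  have htmp := execOps_cons_fwd hR'; clear hR'; obtain ⟨v5, hv5, hR'⟩ := htmp
  simp -failIfUnchanged (disch := omega) only [Operand.write, Operand.read,
    Function.update_self, Function.update_of_ne, BinOp.eval_sub_of_le, Nat.add_zero, h55] at hv5 hR'
  subst v5
  simp only [execOps_nil] at hR'
  subst hR'
  -- untouched cells go all the way back to `st`
  have hback : ∀ c, (c < 55 ∨ 72 < c) →
      ¬ (levelBase rL R N q (j + 1) ≤ c ∧ c < levelBase rL R N q (j + 2)) → mm c = st.mem c := by
    intro c hc hnc
    rw [hfr c (by omega) (by omega) (by omega) (by omega) (by omega) (by omega) (by omega) (by omega)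
      (by omega) (by omega) (by omega) (by omega) (by rwa [hbase2]),
      gfr c (by omega) (by omega) (by omega) (by omega)]
  refine ⟨rfl, ?_, ?_, ?_, ?_, ?_, ?_, ?_, ?_, fun j' hj' P A hP hA => ?_, fun c hc hnc => ?_⟩ <;>
    dsimp only
  · simp (disch := omega) only [Function.update_of_ne, Function.update_self]; exact h50
  · simp (disch := omega) only [Function.update_of_ne, Function.update_self]; exact h52
  · simp (disch := omega) only [Function.update_of_ne, Function.update_self]; exact h53
  · simp (disch := omega) only [Function.update_of_ne, Function.update_self]; omega
  · simp (disch := omega) only [Function.update_of_ne, Function.update_self]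
  · simp (disch := omega) only [Function.update_of_ne, Function.update_self]
  · simp (disch := omega) only [Function.update_of_ne, Function.update_self]
    rw [Nat.mod_mul_mod, ← pow_succ]
  · simp (disch := omega) only [Function.update_of_ne, Function.update_self]
    rw [← hszA, Nat.div_div_eq_div_mul, ← pow_succ]
  · -- data
    rcases Nat.lt_succ_iff_lt_or_eq.1 (Nat.lt_succ_of_le hj') with hlt | rfl
    · -- an old level, below `Bc`
      have hjq : j' ≤ q := by omega
      have hin : P * N ^ (q - j') + A < R ^ j' * N ^ (q - j') := by
        have := seg_le (szA := N ^ (q - j')) hP; omega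
      have hb' : levelBase rL R N q j' + R ^ j' * N ^ (q - j') ≤ levelBase rL R N q (j + 1) := by
        rw [← levelBase_succ]; exact levelBase_mono _ _ _ _ (by omega)
      have hb0' : rL ≤ levelBase rL R N q j' := by
        have := levelBase_mono rL R N q (Nat.zero_le j'); rwa [levelBase_zero] at this
      simp (disch := omega) only [Function.update_of_ne, Function.update_self]
      rw [hback _ (by omega) (by omega)]
      exact h.data j' (by omega) P A hP hA
    · -- the new level
      simp (disch := omega) only [Function.update_of_ne, Function.update_self]
      have hin : P * N ^ (q - (j + 1)) + A < R ^ (j + 1) * N ^ (q - (j + 1)) := by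
        have := seg_le (szA := N ^ (q - (j + 1))) hP; omega
      rw [hwr P A hP hA]
      refine pVal_eq_levN (m₀ := st.mem) hN hR hj (h.data j le_rfl) (fun i d hi hd => ?_)
        (fun c hc1 hc2 => ?_) hP hA
      · have := coef_row_le (rU := rU) (N := N) hi
        rw [gfr _ (by omega) (by omega) (by omega) (by omega),
          h.frame _ (by omega) (by omega)]
      · exact gfr c (by omega) (by omega) (by omega) (by omega)
  · simp (disch := omega) only [Function.update_of_ne, Function.update_self]
    rw [hback c hc (fun hh => hnc ⟨by omega, by omega⟩)]
    exact h.frame c hc hnc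

/-- **One level**: from `LInv j` (`j < q`) the level body reaches `LInv (j + 1)` within
`(8N + 23) · dpSize + 12` steps. [cite: BurgisserClausenShokrollahi1997, Prop. 15.26] -/
theorem levelBody_spec {m : ℕ → ℕ} {rU rL N R q : ℕ} {qs : List (List ℕ)} {j : ℕ} (hj : j < q)
    (hS : LSide w m rU rL N R q) {st : Store} (h : LInv (w := w) m rU rL N R q qs j st) :
    ∃ st', ExecLE w O levelBody st st' ((8 * N + 23) * dpSize R N q + 10) ∧
      LInv (w := w) m rU rL N R q qs (j + 1) st' := by
  obtain ⟨hszA, ht2, hSPle, hNle, hbase2, hbase_le⟩ := level_sizes (rL := rL) hS.hN hS.hR hj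
  obtain ⟨st₁, hex₁, hP, g55, g58, gfr⟩ := lPre_spec (w := w) (O := O) hj hS h
  have hlev := pow_mul_pow_le_dpSize R N q (show j + 1 ≤ q by omega)
  have hlevj := pow_mul_pow_le_dpSize R N q (show j ≤ q by omega)
  have htop := levelBase_top rL R N q
  have hfit := hS.hfit
  have hb0 : rL ≤ levelBase rL R N q j := by
    have := levelBase_mono rL R N q (Nat.zero_le j); rwa [levelBase_zero] at this
  have hbj : levelBase rL R N q j ≤ levelBase rL R N q (j + 1) := levelBase_mono _ _ _ _ (by omega)
  have hrL1 : rL ≤ levelBase rL R N q 1 := by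
    have := levelBase_mono rL R N q (Nat.zero_le 1); rwa [levelBase_zero] at this
  have hPS : PSide w st₁.mem rU N R (levelBase rL R N q j) (levelBase rL R N q (j + 1))
      (N ^ (q - (j + 1))) (R ^ (j + 1)) (N ^ (q - j)) := by
    have hrU := hS.hrU; have hcoef := hS.hcoef; have hR := hS.hR
    refine ⟨hrU, by omega, hR, by omega, fun P hP => ?_, by omega, by omega, fun i d hi hd => ?_⟩
    · have hdiv : P / R < R ^ j := by
        rw [Nat.div_lt_iff_lt_mul (by omega)]; rwa [← pow_succ]
      have := seg_le (szA := N ^ (q - j)) hdiv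
      rw [levelBase_succ]; omega
    · have := coef_row_le (rU := rU) (N := N) hi
      rw [gfr _ (by omega) (by omega) (by omega) (by omega), h.frame _ (by omega) (by omega)]
      exact hS.hcv i d hi hd
  obtain ⟨st₂, hex₂, hP₂⟩ := pLoop_spec (w := w) (O := O) hPS hP
  obtain ⟨st₃, hex₃, hL⟩ := lPost_spec (w := w) (O := O) hj hS h ⟨g55, g58, gfr⟩ hP₂
  refine ⟨st₃, ((hex₁.execLE).seq (hex₂.seq hex₃.execLE)).mono ?_, hL⟩
  -- `4 + (R^{j+1} (N^{q-j-1} (8N+14) + 9) + 1) + 5 ≤ (8N+23) dpSize + 10`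
  have h1 : R ^ (j + 1) * (N ^ (q - (j + 1)) * (N * 8 + 14) + 9) ≤
      (8 * N + 23) * (R ^ (j + 1) * N ^ (q - (j + 1))) := by
    have hX : 1 ≤ N ^ (q - (j + 1)) := Nat.pow_pos hS.hN
    have h9 : R ^ (j + 1) * 9 ≤ R ^ (j + 1) * (N ^ (q - (j + 1)) * 9) :=
      Nat.mul_le_mul_left _ (by nlinarith)
    calc R ^ (j + 1) * (N ^ (q - (j + 1)) * (N * 8 + 14) + 9)
        = R ^ (j + 1) * (N ^ (q - (j + 1)) * (N * 8 + 14)) + R ^ (j + 1) * 9 := by ring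
      _ ≤ R ^ (j + 1) * (N ^ (q - (j + 1)) * (N * 8 + 14)) + R ^ (j + 1) * (N ^ (q - (j + 1)) * 9) :=
          Nat.add_le_add_left h9 _
      _ = (8 * N + 23) * (R ^ (j + 1) * N ^ (q - (j + 1))) := by ring
  have h2 : (8 * N + 23) * (R ^ (j + 1) * N ^ (q - (j + 1))) ≤ (8 * N + 23) * dpSize R N q :=
    Nat.mul_le_mul_left _ hlev
  omega

/-- **The level tables on the word RAM.** From a memory holding the input vector `x` (level `0`,
`N^q` words) at `rL` and the coefficient table at `rU`, with registers `50 = rU`, `52 = N`,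
`53 = R`, `55 = q`, `56 = rL`, `57 = rL + N^q`, `58 = R`, `59 = N^{q-1}` (side conditions
`LSide`), `dpProg` ends within `dpTime N R q` steps in a memory in which, for every `j ≤ q`,
level `j` at `levelBase rL R N q j` holds `levN j` — the level tables of the bilinear algorithm
modulo `2^w` — and nothing outside the registers `55–72` and the levels `1, …, q` has changed.
[cite: BurgisserClausenShokrollahi1997, Prop. 15.26] -/
theorem dpProg_spec {m : ℕ → ℕ} {rU rL N R q : ℕ} (hS : LSide w m rU rL N R q)
    (h50 : m 50 = rU) (h52 : m 52 = N) (h53 : m 53 = R) (h55 : m 55 = q) (h56 : m 56 = rL)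
    (h57 : m 57 = rL + N ^ q) (h58 : m 58 = R) (h59 : m 59 = N ^ (q - 1)) (qs : List (List ℕ)) :
    ∃ st', ExecLE w O dpProg ⟨m, qs⟩ st' (dpTime N R q) ∧ LInv (w := w) m rU rL N R q qs q st' := by
  have hR2 : R < 2 ^ w := by
    have := pow_mul_pow_le_dpSize R N q (Nat.zero_le q)
    have h1 : R ^ 0 * N ^ (q - 0) ≥ 1 := Nat.le_mul_of_pos_right _ (Nat.pow_pos hS.hN) |>.trans' (by simp)
    have htop := levelBase_top rL R N q
    have hfit := hS.hfit
    -- `R ≤ dpSize` unless `q = 0`; in all cases `R ≤ rL + dpSize` fails to be needed: use `R ≤ R * N ≤ rL`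
    have : R ≤ R * N := Nat.le_mul_of_pos_right _ (by have := hS.hN; omega)
    have := hS.hcoef
    have hb0 : rL ≤ levelBase rL R N q (q + 1) := by
      have := levelBase_mono rL R N q (Nat.zero_le (q + 1)); rwa [levelBase_zero] at this
    omega
  have h0 : LInv (w := w) m rU rL N R q qs 0 ⟨m, qs⟩ := by
    refine ⟨rfl, h50, h52, h53, by simpa using h55, by simpa using h56, ?_, ?_, ?_,
      fun j' hj' P A hP hA => ?_, fun c _ _ => rfl⟩
    · show m 57 = levelBase rL R N q (0 + 1)
      rw [levelBase_succ, levelBase_zero, pow_zero, one_mul, Nat.sub_zero]; exact h57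
    · show m 58 = R ^ (0 + 1) % 2 ^ w
      rw [zero_add, pow_one, Nat.mod_eq_of_lt hR2]; exact h58
    · show m 59 = N ^ (q - 1) / N ^ 0
      rw [pow_zero, Nat.div_one]; exact h59
    · obtain rfl : j' = 0 := Nat.le_zero.1 hj'
      have hP0 : P = 0 := by simpa using hP
      subst hP0
      simp
  obtain ⟨st', hex, hL⟩ := ExecLE.whilenz_invariant (w := w) (O := O) (x := .dir 55) (s := levelBody)
    q ((8 * N + 23) * dpSize R N q + 10) (fun j st => LInv (w := w) m rU rL N R q qs j st)
    (fun j hj st hst => ⟨by rw [Operand.read_dir, hst.r55]; omega, levelBody_spec hj hS hst⟩)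
    (fun st hst => by rw [Operand.read_dir, hst.r55]; omega) h0
  refine ⟨st', hex.mono (le_of_eq ?_), hL⟩
  unfold dpTime
  rfl

end SProg

end Literature.Computability.Cryptography.WordRAM
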